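import Summits.CriticalPhenomena.Ising3D.ExclusionSentencesKacx

/-!
# Exclusion sentences — 2D-control instances for the `KACX` tables (cell `pub-ising3x`, seat recog-1)

HONEST FRAMING: lottery ticket; floor = tightest certified 3D Ising CFT bounds; no exact-solution
claim without a proof.

Kernel twins of the frozen recogniser's `KACX` verdict on the 2D control value `Δ_σ = 1/8` at six
certified digits (blind round R2, §3.7: family KACX accepts `1/8` from `k = 6`): within `10⁻⁶` of `1/8`
the ONLY member of the `SU(2)_k` table (`k+2 ≤ 40`; `1/8 = h_{1/2}(SU(2)_4) = 2h_{1/2}(SU(2)_{10})`), of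
the `N = 1` table (`p′ ≤ 24`), of the `ℤ_k` table (`k+2 ≤ 40`) and of the `W3(p, 16)` tables is `1/8`
itself — one `decide +kernel` each (SU2 < 1 s, N1 ≈ 8 s, ZK ≈ 20 s, W3 at `p′ = 16` ≈ 20 s). The other
twelve `W3` levels `p′ = 4..15` have no member within `10⁻³` of `1/8` except `17/135 (p′=10)`,
`37/297 (11)`, `18/143 (13)`, `34/273 (14)`, `62/495 (15)` — checked by the kernel off-tree (seat folder
`work/KacxCombinedTest2.lean`, farm rc 0, 94 s) and not repeated here to keep the tree's build light.
No 3D digit is used.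
-/

namespace Summit.CriticalPhenomena.Ising3D

/-- 2D control, `SU(2)_k` tables (`k + 2 ≤ 40`): the only member in `[1/8 − 10⁻⁶, 1/8 + 10⁻⁶]` is `1/8`. -/
theorem su2Excluded_control_sigma :
    su2Excluded 40 (1 / 8 - 1 / 10 ^ 6) (1 / 8 + 1 / 10 ^ 6) [1 / 8] = true := by
  decide +kernel

/-- … and not vacuously: with an empty exception list the checker answers `false`. -/
theorem su2Excluded_control_sigma_nonvacuous :
    su2Excluded 40 (1 / 8 - 1 / 10 ^ 6) (1 / 8 + 1 / 10 ^ 6) [] = false := by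
  decide +kernel

/-- 2D control, `N = 1` superconformal tables (`p′ ≤ 24`): the only member within `10⁻⁶` of `1/8` is `1/8`. -/
theorem n1Excluded_control_sigma :
    n1Excluded 24 (1 / 8 - 1 / 10 ^ 6) (1 / 8 + 1 / 10 ^ 6) [1 / 8] = true := by
  decide +kernel

/-- 2D control, `ℤ_k` parafermion tables (`k + 2 ≤ 40`): the only member within `10⁻⁶` of `1/8` is `1/8`. -/
theorem zkExcluded_control_sigma :
    zkExcluded 40 (1 / 8 - 1 / 10 ^ 6) (1 / 8 + 1 / 10 ^ 6) [1 / 8] = true := by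
  decide +kernel

/-- 2D control, `W3(p, 16)` tables: the only member within `10⁻⁶` of `1/8` is `1/8`. -/
theorem w3ExcludedPP_sixteen_control_sigma :
    w3ExcludedPP 16 (1 / 8 - 1 / 10 ^ 6) (1 / 8 + 1 / 10 ^ 6) [1 / 8] = true := by
  decide +kernel

end Summit.CriticalPhenomena.Ising3D
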